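import Literature.AlgebraicTopology.Homotopy.DiscAttachmentHomotopy
import Mathlib.Topology.CWComplex.Classical.Finite
import Mathlib.Data.Finite.Sum
import Literature.AlgebraicTopology.Homotopy.ExhaustionCWType

/-!
# Attaching discs to a finite CW complex along maps into lower cells gives a finite CW complex

Topic `Literature/AlgebraicTopology/Homotopy`, sequel of `DiscAttachment.lean` and
`DiscAttachmentHomotopy.lean`.  Hatcher, *Algebraic Topology* (2002), p. 5 (the inductive
construction of CW complexes: `Xⁿ` is formed from `Xⁿ⁻¹` by attaching `n`-cells) and Appendix,
Prop. A.2; Milnor, *Morse theory* (1963), proof of Thm. 3.5 (attaching a `λ`-cell to a CW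
complex along a map into the `(λ-1)`-skeleton gives a CW complex).  In Mathlib's classical CW
complexes (`Topology.CWComplex`, relaxed constructor `Topology.CWComplex.mkFinite` for finite
complexes; no attaching constructions in the pinned version) we PROVE:

* `DiscAttach.cwComplex ψ hdim : CWComplex (univ : Set (DiscAttach ψ))` — for a Hausdorff space
  `K` with a finite CW structure all of whose cells have dimension `< d`
  (`hdim : ∀ m, d ≤ m → IsEmpty (cell K m)`) and finitely many attaching maps
  `ψᵢ : S^{d-1} → K`, the adjunction space `K ∪_ψ ⊔ᵢ Dᵈ` is a finite CW complex whose cells are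
  those of `K` (pushed forward along the embedding `K ↪ K ∪_ψ ⊔ᵢ Dᵈ`) and one `d`-cell for each
  `i` (characteristic map `inD i`, extended to `ℝᵈ` by the radial clamp); the dimension
  hypothesis makes the attaching maps land in cells of lower dimension, as `mkFinite` demands;
* `DiscAttach.finite_cwComplex`, `DiscAttach.isEmpty_cell_cwComplex_of`,
  `DiscAttach.isEmpty_cell_cwComplex` (no cells of dimension `> d`; no new cells in dimension
  `m ≠ d`), packaged as `DiscAttach.exists_cwComplex`;
* on the way (`compactSpace_of_finite_cwComplex` of `ExhaustionCWType.lean`: a finite CW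
  complex is compact): `DiscAttach.isOpen_image_discChart` (the open cells of the discs are open and the
  characteristic maps are open on the open ball), `DiscAttach.continuousOn_invFunOn_univ`.

This is the combinatorial input of the tree's discharge of Milnor 1963, Thm. 3.5 (handlebodies
have the homotopy type of finite CW complexes of bounded dimension,
`Literature/Topology/FourManifolds/HandlebodyCWStructure.lean`).  No named facts, no `sorry`.

## References

* A. Hatcher, *Algebraic Topology*, CUP (2002), Ch. 0 p. 5; Appendix pp. 519–523 (Prop. A.2).
  [HatcherAT2002]
* J. Milnor, *Morse theory*, Ann. of Math. Studies 51 (1963), §3, proof of Thm. 3.5.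
  [Milnor1963]
-/

noncomputable section

open Set Function Metric Topology

universe u

namespace Literature.AlgebraicTopology.Homotopy

/-- Local notation: the model disc and sphere. -/
local notation "𝔻 " d:arg => Metric.closedBall (0 : Fin d → ℝ) 1
local notation "𝕊 " d:arg => Metric.sphere (0 : Fin d → ℝ) 1

/-! ### A point-set preliminary -/

/-- The inverse of a continuous injection of a compact space into a Hausdorff space is continuous
on the image. [folklore] -/
theorem DiscAttach.continuousOn_invFunOn_univ {A B : Type*} [TopologicalSpace A]
    [TopologicalSpace B] [CompactSpace A] [T2Space B] [Nonempty A] {f : A → B} (hf : Continuous f)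
    (hinj : Injective f) : ContinuousOn (invFunOn f univ) (f '' univ) := by
  have hemb := (hf.isClosedEmbedding hinj).isEmbedding
  rw [continuousOn_iff_continuous_restrict]
  have heq : (f '' univ).restrict (invFunOn f univ) = fun m : ↥(f '' univ) =>
      hemb.toHomeomorph.symm ⟨m.1, by obtain ⟨a, -, ha⟩ := m.2; exact ⟨a, ha⟩⟩ := by
    funext ⟨m, hm⟩
    obtain ⟨a, -, rfl⟩ := hm
    change invFunOn f univ (f a) = _
    rw [hinj.injOn.leftInvOn_invFunOn (mem_univ a)]
    exact (hemb.toHomeomorph_symm_apply a).symm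
  rw [heq]
  exact hemb.toHomeomorph.symm.continuous.comp (continuous_subtype_val.subtype_mk _)

namespace DiscAttach

variable {K : Type u} [TopologicalSpace K] {ι : Type} {d : ℕ} (ψ : ι → C(↥(𝕊 d), K))

/-! ### The open cells of the attached discs -/

/-- The characteristic map of the `i`-th attached disc, extended to all of `ℝᵈ` by the radial
clamp `toBall` (Mathlib's CW cells are partial equivalences on `Fin d → ℝ`). [folklore] -/
def discChart (i : ι) (y : Fin d → ℝ) : DiscAttach ψ := inD ψ i (toBall y)

/-- `discChart` is continuous. [folklore] -/
theorem continuous_discChart (i : ι) : Continuous (discChart ψ i) :=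
  (inD ψ i).continuous.comp continuous_toBall

/-- On the closed ball `discChart` is the characteristic map. [folklore] -/
theorem discChart_of_mem (i : ι) {y : Fin d → ℝ} (hy : y ∈ closedBall (0 : Fin d → ℝ) 1) :
    discChart ψ i y = inD ψ i ⟨y, hy⟩ := by
  unfold discChart
  congr 1
  exact Subtype.ext (toBall_of_norm_le (mem_closedBall_zero_iff.1 hy))

/-- Points of the open ball are not on the sphere. [folklore] -/
theorem not_onSphere_of_mem_ball {y : Fin d → ℝ} (hy : y ∈ ball (0 : Fin d → ℝ) 1) :
    ¬ OnSphere (⟨y, ball_subset_closedBall hy⟩ : ↥(𝔻 d)) := by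
  unfold OnSphere
  rw [mem_ball_zero_iff] at hy
  exact hy.ne

/-- `discChart` is injective on the open ball. [folklore] -/
theorem injOn_discChart (i : ι) : InjOn (discChart ψ i) (ball 0 1) := by
  intro y hy y' hy' h
  rw [discChart_of_mem ψ i (ball_subset_closedBall hy),
    discChart_of_mem ψ i (ball_subset_closedBall hy')] at h
  have := ((inD_eq_inD_iff_of_not_onSphere ψ (not_onSphere_of_mem_ball hy)).1 h).2
  exact congrArg Subtype.val (eq_of_heq this)

/-- The saturation of the image of a subset of the open ball: only the disc itself. [folklore] -/
theorem mk_preimage_image_discChart (i : ι) {U : Set (Fin d → ℝ)} (hU : U ⊆ ball 0 1) :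
    mk ψ ⁻¹' (discChart ψ i '' U) =
      (Sum.inr ∘ Sigma.mk i) '' ((Subtype.val : ↥(𝔻 d) → Fin d → ℝ) ⁻¹' U) := by
  ext p
  constructor
  · rintro ⟨y, hyU, hy⟩
    rw [discChart_of_mem ψ i (ball_subset_closedBall (hU hyU))] at hy
    rcases p with z | ⟨i', x⟩
    · exact absurd hy (inD_ne_inZ_of_not_onSphere ψ (not_onSphere_of_mem_ball (hU hyU)) z)
    · obtain ⟨rfl, hx⟩ :=
        (inD_eq_inD_iff_of_not_onSphere ψ (not_onSphere_of_mem_ball (hU hyU))).1 hy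
      have hx' := eq_of_heq hx
      refine ⟨x, ?_, rfl⟩
      show (x : Fin d → ℝ) ∈ U
      rw [← hx']
      exact hyU
  · rintro ⟨x, hxU, rfl⟩
    refine ⟨x, hxU, ?_⟩
    rw [discChart_of_mem ψ i x.2]
    rfl

/-- The image of an open subset of the open ball under `discChart` is open in the attachment
space. [folklore] -/
theorem isOpen_image_discChart (i : ι) {U : Set (Fin d → ℝ)} (hUo : IsOpen U)
    (hU : U ⊆ ball 0 1) : IsOpen (discChart ψ i '' U) := by
  rw [← (isQuotientMap_mk ψ).isOpen_preimage, mk_preimage_image_discChart ψ i hU]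
  exact (isOpenMap_inr.comp isOpenMap_sigmaMk) _ (hUo.preimage continuous_subtype_val)

/-- The `i`-th new `d`-cell as a partial equivalence `ℝᵈ ⇀ K ∪_ψ ⊔ᵢ Dᵈ` (open ball onto open
cell). [folklore] -/
def newMap (i : ι) : PartialEquiv (Fin d → ℝ) (DiscAttach ψ) :=
  (injOn_discChart ψ i).toPartialEquiv (discChart ψ i) (ball 0 1)

/-- `newMap` as a function is `discChart`. [folklore] -/
@[simp] theorem coe_newMap (i : ι) : (newMap ψ i : (Fin d → ℝ) → DiscAttach ψ) = discChart ψ i :=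
  rfl

/-- The source of `newMap` is the open ball. [folklore] -/
@[simp] theorem newMap_source (i : ι) : (newMap ψ i).source = ball 0 1 := rfl

/-- The target of `newMap` is the open cell. [folklore] -/
@[simp] theorem newMap_target (i : ι) : (newMap ψ i).target = discChart ψ i '' ball 0 1 := rfl

/-- The inverse of `newMap` is continuous on the open cell (the open cell is open and `discChart`
is an open map on the open ball). [folklore] -/
theorem continuousOn_newMap_symm (i : ι) :
    ContinuousOn (newMap ψ i).symm (newMap ψ i).target := by
  rw [newMap_target, continuousOn_open_iff (isOpen_image_discChart ψ i isOpen_ball Subset.rfl)]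
  intro t ht
  have heq : discChart ψ i '' ball 0 1 ∩ (newMap ψ i).symm ⁻¹' t = discChart ψ i '' (ball 0 1 ∩ t) := by
    ext m
    constructor
    · rintro ⟨⟨y, hy, rfl⟩, hm⟩
      refine ⟨y, ⟨hy, ?_⟩, rfl⟩
      have : (newMap ψ i).symm (discChart ψ i y) = y :=
        (newMap ψ i).left_inv (by rw [newMap_source]; exact hy)
      rw [mem_preimage, this] at hm
      exact hm
    · rintro ⟨y, ⟨hy, hyt⟩, rfl⟩
      refine ⟨⟨y, hy, rfl⟩, ?_⟩
      have : (newMap ψ i).symm (discChart ψ i y) = y :=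
        (newMap ψ i).left_inv (by rw [newMap_source]; exact hy)
      rw [mem_preimage, this]
      exact hyt
  rw [heq]
  exact isOpen_image_discChart ψ i (isOpen_ball.inter ht) inter_subset_left

/-! ### The old cells -/

/-- The base `K ↪ K ∪_ψ ⊔ᵢ Dᵈ` as a partial equivalence (`K` nonempty). [folklore] -/
def baseEquiv [Nonempty K] : PartialEquiv K (DiscAttach ψ) :=
  (inZ_injective ψ).injOn.toPartialEquiv (inZ ψ) univ

variable [CWComplex (univ : Set K)]

/-- An old cell of `K`, pushed into `K ∪_ψ ⊔ᵢ Dᵈ`. [folklore] -/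
def oldMap (n : ℕ) (j : RelCWComplex.cell (univ : Set K) n) :
    PartialEquiv (Fin n → ℝ) (DiscAttach ψ) :=
  haveI : Nonempty K := ⟨RelCWComplex.map n j 0⟩
  (RelCWComplex.map n j).trans (baseEquiv ψ)

/-- `oldMap` as a function. [folklore] -/
theorem coe_oldMap (n : ℕ) (j : RelCWComplex.cell (univ : Set K) n) :
    (oldMap ψ n j : (Fin n → ℝ) → DiscAttach ψ) = inZ ψ ∘ RelCWComplex.map n j := rfl

/-- The source of `oldMap` is the open ball. [folklore] -/
theorem oldMap_source (n : ℕ) (j : RelCWComplex.cell (univ : Set K) n) :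
    (oldMap ψ n j).source = ball 0 1 := by
  rw [oldMap, PartialEquiv.trans_source, RelCWComplex.source_eq]
  simp [baseEquiv]

/-- Images under `oldMap`. [folklore] -/
theorem image_oldMap (n : ℕ) (j : RelCWComplex.cell (univ : Set K) n) (s : Set (Fin n → ℝ)) :
    oldMap ψ n j '' s = inZ ψ '' (RelCWComplex.map n j '' s) := by
  rw [coe_oldMap, image_comp]

/-! ### The cells of `K ∪_ψ ⊔ᵢ Dᵈ` -/

/-- The cells of `K ∪_ψ ⊔ᵢ Dᵈ` in dimension `n`: the cells of `K`, plus — in dimension `d` — one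
cell for each `i : ι`. [folklore] -/
def Cell (K : Type u) [TopologicalSpace K] [CWComplex (univ : Set K)] (ι : Type) (d n : ℕ) : Type u :=
  RelCWComplex.cell (univ : Set K) n ⊕ ULift.{u} {_i : ι // n = d}

/-- The characteristic maps of `K ∪_ψ ⊔ᵢ Dᵈ`. [folklore] -/
def cellMap : (n : ℕ) → Cell K ι d n → PartialEquiv (Fin n → ℝ) (DiscAttach ψ)
  | n, Sum.inl j => oldMap ψ n j
  | _, Sum.inr ⟨⟨i, rfl⟩⟩ => newMap ψ i

/-- `cellMap` on old cells. [folklore] -/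
@[simp] theorem cellMap_inl (n : ℕ) (j : RelCWComplex.cell (univ : Set K) n) :
    cellMap ψ n (Sum.inl j) = oldMap ψ n j := rfl

/-- `cellMap` on new cells. [folklore] -/
@[simp] theorem cellMap_inr (i : ι) :
    cellMap ψ d (Sum.inr ⟨⟨i, rfl⟩⟩) = newMap ψ i := rfl

/-! ### The CW structure -/

/-- Old open cells are disjoint from new open cells. [folklore] -/
theorem disjoint_image_oldMap_image_discChart (n : ℕ) (j : RelCWComplex.cell (univ : Set K) n)
    (i : ι) : Disjoint (oldMap ψ n j '' ball 0 1) (discChart ψ i '' ball 0 1) := by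
  rw [image_oldMap]
  refine Set.disjoint_left.2 ?_
  rintro _ ⟨k, -, rfl⟩ ⟨y, hy, hy'⟩
  rw [discChart_of_mem ψ i (ball_subset_closedBall hy)] at hy'
  exact inD_ne_inZ_of_not_onSphere ψ (not_onSphere_of_mem_ball hy) _ hy'

/-- If `K` has no cells of dimension `≥ d`, every cell of `K` has dimension `< d`. [folklore] -/
theorem lt_of_cell (hdim : ∀ m, d ≤ m → IsEmpty (RelCWComplex.cell (univ : Set K) m)) {m : ℕ}
    (j : RelCWComplex.cell (univ : Set K) m) : m < d := by
  by_contra h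
  exact (hdim m (not_lt.1 h)).false j

/-- If `K` has no cells of dimension `≥ d`, every point of `K` lies in a closed cell of dimension
`< d`. [folklore] -/
theorem exists_mem_closedCell (hdim : ∀ m, d ≤ m → IsEmpty (RelCWComplex.cell (univ : Set K) m))
    (k : K) :
    ∃ m, m < d ∧ ∃ j : RelCWComplex.cell (univ : Set K) m, k ∈ RelCWComplex.closedCell m j := by
  have hk : k ∈ ⋃ (n : ℕ) (j : RelCWComplex.cell (univ : Set K) n), RelCWComplex.closedCell n j := by
    rw [CWComplex.union]; exact mem_univ k
  simp only [mem_iUnion] at hk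
  obtain ⟨m, j, hj⟩ := hk
  exact ⟨m, lt_of_cell hdim j, j, hj⟩

/-- **`K ∪_ψ ⊔ᵢ Dᵈ` is a finite CW complex** when `K` is a finite CW complex all of whose cells
have dimension `< d` (so that the attaching maps are automatically cellular) and finitely many
`d`-discs are attached: the cells are those of `K` and one `d`-cell for each disc (Hatcher,
*Algebraic Topology* (2002), p. 5 and Prop. A.2: a CW complex is built exactly by such
attachments; Mathlib's relaxed constructor `CWComplex.mkFinite`). [folklore] -/
@[reducible]
def cwComplex [T2Space K] [RelCWComplex.Finite (univ : Set K)] [Finite ι]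
    (hdim : ∀ m, d ≤ m → IsEmpty (RelCWComplex.cell (univ : Set K) m)) :
    CWComplex (univ : Set (DiscAttach ψ)) :=
  haveI : CompactSpace K := compactSpace_of_finite_cwComplex K
  CWComplex.mkFinite (univ : Set (DiscAttach ψ)) (Cell K ι d) (cellMap ψ)
    (eventually_isEmpty_cell := Filter.eventually_atTop.2 ⟨d + 1, fun n hn => by
        haveI := hdim n (by omega)
        haveI : IsEmpty {_i : ι // n = d} := ⟨fun x => by have := x.2; omega⟩
        unfold Cell; infer_instance⟩)
    (finite_cell := fun n => by
        haveI : _root_.Finite (RelCWComplex.cell (univ : Set K) n) :=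
          RelCWComplex.FiniteType.finite_cell n
        unfold Cell; infer_instance)
    (source_eq := by
        rintro n (j | ⟨⟨i, rfl⟩⟩)
        · exact oldMap_source ψ n j
        · rfl)
    (continuousOn := by
        rintro n (j | ⟨⟨i, rfl⟩⟩)
        · rw [cellMap_inl, coe_oldMap]
          exact (inZ ψ).continuous.comp_continuousOn (RelCWComplex.continuousOn n j)
        · rw [cellMap_inr, coe_newMap]; exact (continuous_discChart ψ i).continuousOn)
    (continuousOn_symm := by
        rintro n (j | ⟨⟨i, rfl⟩⟩)
        · rw [cellMap_inl]
          haveI : Nonempty K := ⟨RelCWComplex.map n j 0⟩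
          change ContinuousOn ((RelCWComplex.map n j).symm ∘ (baseEquiv ψ).symm)
            ((RelCWComplex.map n j).trans (baseEquiv ψ)).target
          rw [PartialEquiv.trans_target]
          refine (RelCWComplex.continuousOn_symm n j).comp ?_ (fun m hm => hm.2)
          exact (continuousOn_invFunOn_univ (inZ ψ).continuous (inZ_injective ψ)).mono
            inter_subset_left
        · rw [cellMap_inr]; exact continuousOn_newMap_symm ψ i)
    (pairwiseDisjoint' := by
        rintro ⟨n, c⟩ - ⟨n', c'⟩ - hne
        rcases c with j | ⟨⟨i, rfl⟩⟩ <;> rcases c' with j' | ⟨⟨i', rfl⟩⟩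
        · change Disjoint (oldMap ψ n j '' ball 0 1) (oldMap ψ n' j' '' ball 0 1)
          rw [image_oldMap, image_oldMap, Set.disjoint_image_iff (inZ_injective ψ)]
          refine RelCWComplex.disjoint_openCell_of_ne fun h => hne ?_
          cases h; rfl
        · exact disjoint_image_oldMap_image_discChart ψ n j i'
        · exact (disjoint_image_oldMap_image_discChart ψ n' j' i).symm
        · change Disjoint (discChart ψ i '' ball 0 1) (discChart ψ i' '' ball 0 1)
          refine Set.disjoint_left.2 ?_
          rintro _ ⟨y, hy, rfl⟩ ⟨y', hy', h⟩
          rw [discChart_of_mem ψ i (ball_subset_closedBall hy),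
            discChart_of_mem ψ i' (ball_subset_closedBall hy')] at h
          have := ((inD_eq_inD_iff_of_not_onSphere ψ (not_onSphere_of_mem_ball hy')).1 h).1
          subst this
          exact hne rfl)
    (mapsTo_iff_image_subset := by
        rintro n (j | ⟨⟨i, rfl⟩⟩)
        · intro y hy
          have hmem : RelCWComplex.map n j y ∈ RelCWComplex.cellFrontier n j := ⟨y, hy, rfl⟩
          obtain ⟨J, hJ⟩ := CWComplex.cellFrontier_subset_finite_closedCell (C := (univ : Set K)) n j
          have h2 := hJ hmem
          simp only [mem_iUnion] at h2
          obtain ⟨m, hm, j', -, hj'⟩ := h2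
          rw [cellMap_inl, coe_oldMap]
          refine mem_iUnion.2 ⟨m, mem_iUnion.2 ⟨hm, mem_iUnion.2 ⟨Sum.inl j', ?_⟩⟩⟩
          rw [cellMap_inl, image_oldMap]
          exact mem_image_of_mem _ hj'
        · intro y hy
          have hy1 := sphere_subset_closedBall hy
          have hsph : OnSphere ⟨y, hy1⟩ := by
            unfold OnSphere; exact mem_sphere_zero_iff_norm.1 hy
          rw [cellMap_inr, coe_newMap, discChart_of_mem ψ i hy1, inD_of_onSphere ψ i hsph]
          obtain ⟨m, hm, j', hj'⟩ := exists_mem_closedCell hdim (ψ i (toSphere _ hsph))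
          refine mem_iUnion.2 ⟨m, mem_iUnion.2 ⟨hm, mem_iUnion.2 ⟨Sum.inl j', ?_⟩⟩⟩
          rw [cellMap_inl, image_oldMap]
          exact mem_image_of_mem _ hj')
    (union' := by
        refine eq_univ_of_forall fun m => ?_
        rcases exists_eq ψ m with ⟨k, rfl⟩ | ⟨i, x, -, rfl⟩
        · obtain ⟨n, -, j, hj⟩ := exists_mem_closedCell hdim k
          refine mem_iUnion.2 ⟨n, mem_iUnion.2 ⟨Sum.inl j, ?_⟩⟩
          rw [cellMap_inl, image_oldMap]
          exact mem_image_of_mem _ hj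
        · refine mem_iUnion.2 ⟨d, mem_iUnion.2 ⟨Sum.inr ⟨⟨i, rfl⟩⟩, ?_⟩⟩
          rw [cellMap_inr, coe_newMap]
          refine ⟨x.1, x.2, ?_⟩
          rw [discChart_of_mem ψ i x.2])

variable [T2Space K] [RelCWComplex.Finite (univ : Set K)] [Finite ι]
  (hdim : ∀ m, d ≤ m → IsEmpty (RelCWComplex.cell (univ : Set K) m))

/-- The CW structure `cwComplex` is finite. [folklore] -/
theorem finite_cwComplex :
    letI := cwComplex ψ hdim
    RelCWComplex.Finite (univ : Set (DiscAttach ψ)) :=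
  CWComplex.finite_mkFinite _ _ _ _ _ _ _ _ _ _ _

/-- The cells of `cwComplex` in dimension `m` are those of `K`, plus the new discs when `m = d`:
emptiness criterion. [folklore] -/
theorem isEmpty_cell_cwComplex_of {m : ℕ} (hK : IsEmpty (RelCWComplex.cell (univ : Set K) m))
    (hι : m = d → IsEmpty ι) :
    letI := cwComplex ψ hdim
    IsEmpty (RelCWComplex.cell (univ : Set (DiscAttach ψ)) m) := by
  haveI : IsEmpty {_i : ι // m = d} := ⟨fun x => (hι x.2).false x.1⟩
  show IsEmpty (Cell K ι d m)
  unfold Cell; infer_instance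

/-- The CW structure `cwComplex` has no cells of dimension `> d`. [folklore] -/
theorem isEmpty_cell_cwComplex {m : ℕ} (hm : d < m) :
    letI := cwComplex ψ hdim
    IsEmpty (RelCWComplex.cell (univ : Set (DiscAttach ψ)) m) :=
  isEmpty_cell_cwComplex_of ψ hdim (hdim m hm.le) fun h => absurd h (ne_of_gt hm)

include hdim in
/-- **Attaching finitely many `d`-discs to a finite CW complex with no cells of dimension `≥ d`
gives a finite CW complex with no cells of dimension `> d`** — existence form, with the cell
count criterion: a dimension `m` without cells in `K` has no cells in `K ∪_ψ ⊔ᵢ Dᵈ` unless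
`m = d` and `ι` is nonempty (Hatcher, *Algebraic Topology* (2002), p. 5). [folklore] -/
theorem exists_cwComplex :
    ∃ _ : CWComplex (univ : Set (DiscAttach ψ)), RelCWComplex.Finite (univ : Set (DiscAttach ψ)) ∧
      ∀ m, IsEmpty (RelCWComplex.cell (univ : Set K) m) → (m = d → IsEmpty ι) →
        IsEmpty (RelCWComplex.cell (univ : Set (DiscAttach ψ)) m) :=
  ⟨cwComplex ψ hdim, finite_cwComplex ψ hdim, fun _ hK hι => isEmpty_cell_cwComplex_of ψ hdim hK hι⟩

end DiscAttach

end Literature.AlgebraicTopology.Homotopy
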